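import Summits.ResolutionOfSingularities.ResolutionOfSingularities.Theorems.FrobeniusClosingSteerStrippedThreadChainExists
import HarnessLib

/-!
# Stripped threads, part 3d: the K♭ v2.2 (H) and v2.2-perfect (HP) refutations from the existential Θ1♭ engine (Theses-free, def-free)

W4.1, crux `Steer` (stmt-ResolutionOfSingularities-16345), §σ2.26 v2 (re-cut 060f6b05f5dedd2c): corollaries of
`StrippedThreadExists.exists_strippedChain_of_thread` (part 3c). Given, for the germ at every visit `(R (j (m+1)))_{P (j (m+1))}`, the
member facts H (`hL7`, res-D-pv-004's (L7) shape UNFOLDED) resp. H + perfect residue field (`hperf`), the body of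
`NoEternalStrippedRadicandChainH p c` resp. `NoEternalStrippedRadicandChainHP p c` FAILS for an infinitely stripped thread. Consumers: the
hA3H leaf `strippedThreadTwoNH_holds` (res-D-pv-003) and the hΘ leaf `pointTailChainTwoN_holds` (res-D-pv-011, res-L0-w41-plan-1 RULING 100).
OURS (the W4.1 engine). [cite: Cutkosky2014, §2.1] [cite: NovacoskiSpivakovsky2014, Def. 2.11] [cite: Matsumura1987, Thm. 19.3, Thm. 20.3]
-/

noncomputable section

-- `Summit.<S>.<S>.…` duplicates the summit name by design (single-problem summit).
set_option linter.dupNamespace false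

open Polynomial IsLocalRing Literature.AlgebraicGeometry.Resolution

namespace Summit.ResolutionOfSingularities.ResolutionOfSingularities.Theorems.SwitchingDichotomy.StrippedThreadExists

variable {k : Type} {K : Type} [Field k] [Field K] [Algebra k K]

/-- **K♭ v2.2 body FAILS for an infinitely stripped thread whose germs have ENOUGH DERIVATIONS** (the Θ1♭-H engine): the data of
`exists_strippedChain_of_thread` + `hL7` («the germ at every visit, `(R (j (m+1)))_{P (j (m+1))}`, satisfies `HasCleaningDerivations p` for all `f g`» — the shape
of res-D-pv-004's (L7) `…SteerMemberDerivations`, here UNFOLDED) ⇒ the body of `NoEternalStrippedRadicandChainH p c` (§σ2.26 v2 re-cut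
060f6b05f5dedd2c) fails. OURS. [folklore] -/
theorem not_noEternalStrippedChainH_of_thread (p : ℕ) [hp : Fact p.Prime] [CharP K p]
    (O : ValuationSubring K) (A₀ : Subalgebra k K) (h₀ : A₀.toSubring ≤ O.toSubring) (hfg : A₀.FG)
    (R : ℕ → Subring K) (P : (i : ℕ) → Ideal (R i)) (s : ℕ → K) (c : ℕ)
    (hR0 : R 0 = locAtCentre A₀.toSubring O)
    (hbl : ∀ i, IsLocalBlowupAlong O (R i) (P i) (R (i + 1)))
    (hst : ∀ i, ∃ x g : K, ((∃ hx : x ∈ R i, (⟨x, hx⟩ : R i) ∈ P i) ∧ x ≠ 0 ∧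
      ∀ y : R i, y ∈ P i → O.valuation (y : K) ≤ O.valuation x) ∧ g ∈ R i ∧ s i = x * s (i + 1) + g)
    (hsp : ∀ i, s i ^ p ∈ R i)
    (hregR : ∀ i, IsRegularLocalRing (R i))
    (j : ℕ → ℕ) (hj : StrictMono j)
    (W : (m : ℕ) → Ideal (R m)) (hWprime : ∀ m, j 0 ≤ m → (W m).IsPrime)
    (hWP : ∀ k, W (j k) = P (j k))
    (hWcomap : ∀ m, j 0 ≤ m → ∃ h : R m ≤ R (m + 1), Ideal.comap (Subring.inclusion h) (W (m + 1)) = W m)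
    (hhit : ∀ m, j 0 ≤ m → (∀ k, m ≠ j k) → P m ≤ W m → ∃ _ : (P m).IsPrime, (P m).height ≤ 1 ∧
      ¬ IsRegularLocalRing (AdjoinRoot ((X : (Localization.AtPrime (P m))[X]) ^ p -
        C (algebraMap (R m) (Localization.AtPrime (P m)) ⟨s m ^ p, hsp m⟩))))
    (hinf : ∀ m₀, ∃ m, m₀ ≤ m ∧ (∀ k, m ≠ j k) ∧ P m ≤ W m)
    (hht : ∀ k, (P (j k)).height = c)
    (hquot : ∀ k, IsRegularLocalRing (R (j k) ⧸ P (j k)))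
    (hmult : ∀ k, ∃ g : R (j k), (⟨s (j k) ^ p, hsp (j k)⟩ : R (j k)) - g ^ p ∈ P (j k) ^ p)
    (hmin : ∀ k, ∀ (Q : Ideal (R (j k))) [Q.IsPrime], Q < P (j k) →
      IsRegularLocalRing (AdjoinRoot ((X : (Localization.AtPrime Q)[X]) ^ p -
        C (algebraMap (R (j k)) (Localization.AtPrime Q) ⟨s (j k) ^ p, hsp (j k)⟩))))
    (hCD : ∀ (S S' : Subring K) [IsRegularLocalRing S] [IsRegularLocalRing S'] (hle : S ≤ S'),
      IsQuadraticTransform S S' → ∀ (ξ : K) (hξ : ξ ∈ S'),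
      Ideal.span ((fun y : S => (⟨(y : K), hle y.2⟩ : S')) '' (maximalIdeal S : Set S)) = Ideal.span {(⟨ξ, hξ⟩ : S')} →
      ∀ (f G F : K), f ∈ S → G ∈ S' → F ∈ S' → ∀ e : ℕ, 1 ≤ e → f - G ^ p = ξ ^ (p * e) * F →
      ∃ g h : K, g ∈ S ∧ h ∈ S' ∧ G = g + ξ ^ e * h)
    (hL7 : ∀ (m : ℕ) (T : Subring K) [IsLocalRing T],
      (∀ z : K, z ∈ T ↔ ∃ a b : R (j (m + 1)), b ∉ P (j (m + 1)) ∧ z = (a : K) / b) → ∀ (f g : T),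
        (∀ N : ℕ, (∀ h : T, f - h ^ p ∉ maximalIdeal T ^ (N + 1)) → f - g ^ p ∈ maximalIdeal T ^ N →
            ∃ D : Derivation ℤ T T, D f ∉ maximalIdeal T ^ N ∨
              ((∀ y ∈ maximalIdeal T, D y ∈ maximalIdeal T) ∧ D f ∉ maximalIdeal T ^ (N + 1)))) :
    ¬ (∀ (L : Type) [Field L] [CharP L p] (S : ℕ → Subring L) [∀ m, IsLocalRing (S m)]
        (hle : ∀ m, S m ≤ S (m + 1)) (f g : ∀ m, S m) (x : ∀ m, S (m + 1)) (e : ℕ → ℕ) (_he : ∀ m, 1 ≤ e m)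
        (_hinf : ∀ m₀, ∃ m, m₀ ≤ m ∧ 2 ≤ e m),
        (∀ m, IsRegularLocalRing (S m)) → (∀ m, IsExcellentRing (S m)) → (∀ m, ringKrullDim (S m) = c) →
        (∀ m, IsQuadraticTransform (S m) (S (m + 1))) →
        (∀ m, Ideal.span ((fun y : S m => (⟨(y : L), hle m y.2⟩ : S (m + 1))) '' (maximalIdeal (S m) : Set (S m)))
            = Ideal.span {x m}) →
        (∀ m, ((f (m + 1) : S (m + 1)) : L) * ((x m : S (m + 1)) : L) ^ (p * e m) =
            ((f m : S m) : L) - ((g m : S m) : L) ^ p) →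
        (∀ m, ∃ h : S m, f m - h ^ p ∈ maximalIdeal (S m) ^ p) →
        (∀ m, ∀ N : ℕ, (∀ h : S m, f m - h ^ p ∉ maximalIdeal (S m) ^ (N + 1)) → f m - g m ^ p ∈ maximalIdeal (S m) ^ N →
            ∃ D : Derivation ℤ (S m) (S m), D (f m) ∉ maximalIdeal (S m) ^ N ∨
              ((∀ y ∈ maximalIdeal (S m), D y ∈ maximalIdeal (S m)) ∧ D (f m) ∉ maximalIdeal (S m) ^ (N + 1))) →
        (∀ m, ∀ (Q : Ideal (AdjoinRoot ((X : (S m)[X]) ^ p - C (f m)))) [Q.IsPrime],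
            (∃ Q' : Ideal (AdjoinRoot ((X : (S m)[X]) ^ p - C (f m))), Q'.IsPrime ∧ Q < Q') →
            IsRegularLocalRing (Localization.AtPrime Q)) →
        False) := by
  intro hNo
  obtain ⟨S, hSloc, hle, f, g, x, e, he, hinf', hreg, hexc, hdim, hqt, hspan, hlaw, hmult', hiso, hS⟩ :=
    exists_strippedChain_of_thread p O A₀ h₀ hfg R P s c hR0 hbl hst hsp hregR j hj W hWprime hWP hWcomap hhit hinf hht hquot hmult hmin hCD
  exact hNo K S hle f g x e he hinf' hreg hexc hdim hqt hspan hlaw hmult' (fun m => hL7 m (S m) (hS m) (f m) (g m)) hiso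

/-- **K♭ v2.2-perfect (HP) body FAILS for an infinitely stripped thread whose germs have enough derivations AND perfect residue fields**
(the Θ♮ / F-B♮ currency, res-L0-w41-plan-1 RULING 100): `hL7` as above + `hperf` («the germ at every visit has a perfect residue field»;
for a `CoreDatum` run: ZeroDim + `k` perfect ⇒ `Algebra.IsAlgebraic.perfectField`) ⇒ the body of `NoEternalStrippedRadicandChainHP p c`
fails. OURS. [folklore] -/
theorem not_noEternalStrippedChainHP_of_thread (p : ℕ) [hp : Fact p.Prime] [CharP K p]
    (O : ValuationSubring K) (A₀ : Subalgebra k K) (h₀ : A₀.toSubring ≤ O.toSubring) (hfg : A₀.FG)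
    (R : ℕ → Subring K) (P : (i : ℕ) → Ideal (R i)) (s : ℕ → K) (c : ℕ)
    (hR0 : R 0 = locAtCentre A₀.toSubring O)
    (hbl : ∀ i, IsLocalBlowupAlong O (R i) (P i) (R (i + 1)))
    (hst : ∀ i, ∃ x g : K, ((∃ hx : x ∈ R i, (⟨x, hx⟩ : R i) ∈ P i) ∧ x ≠ 0 ∧
      ∀ y : R i, y ∈ P i → O.valuation (y : K) ≤ O.valuation x) ∧ g ∈ R i ∧ s i = x * s (i + 1) + g)
    (hsp : ∀ i, s i ^ p ∈ R i)
    (hregR : ∀ i, IsRegularLocalRing (R i))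
    (j : ℕ → ℕ) (hj : StrictMono j)
    (W : (m : ℕ) → Ideal (R m)) (hWprime : ∀ m, j 0 ≤ m → (W m).IsPrime)
    (hWP : ∀ k, W (j k) = P (j k))
    (hWcomap : ∀ m, j 0 ≤ m → ∃ h : R m ≤ R (m + 1), Ideal.comap (Subring.inclusion h) (W (m + 1)) = W m)
    (hhit : ∀ m, j 0 ≤ m → (∀ k, m ≠ j k) → P m ≤ W m → ∃ _ : (P m).IsPrime, (P m).height ≤ 1 ∧
      ¬ IsRegularLocalRing (AdjoinRoot ((X : (Localization.AtPrime (P m))[X]) ^ p -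
        C (algebraMap (R m) (Localization.AtPrime (P m)) ⟨s m ^ p, hsp m⟩))))
    (hinf : ∀ m₀, ∃ m, m₀ ≤ m ∧ (∀ k, m ≠ j k) ∧ P m ≤ W m)
    (hht : ∀ k, (P (j k)).height = c)
    (hquot : ∀ k, IsRegularLocalRing (R (j k) ⧸ P (j k)))
    (hmult : ∀ k, ∃ g : R (j k), (⟨s (j k) ^ p, hsp (j k)⟩ : R (j k)) - g ^ p ∈ P (j k) ^ p)
    (hmin : ∀ k, ∀ (Q : Ideal (R (j k))) [Q.IsPrime], Q < P (j k) →
      IsRegularLocalRing (AdjoinRoot ((X : (Localization.AtPrime Q)[X]) ^ p -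
        C (algebraMap (R (j k)) (Localization.AtPrime Q) ⟨s (j k) ^ p, hsp (j k)⟩))))
    (hCD : ∀ (S S' : Subring K) [IsRegularLocalRing S] [IsRegularLocalRing S'] (hle : S ≤ S'),
      IsQuadraticTransform S S' → ∀ (ξ : K) (hξ : ξ ∈ S'),
      Ideal.span ((fun y : S => (⟨(y : K), hle y.2⟩ : S')) '' (maximalIdeal S : Set S)) = Ideal.span {(⟨ξ, hξ⟩ : S')} →
      ∀ (f G F : K), f ∈ S → G ∈ S' → F ∈ S' → ∀ e : ℕ, 1 ≤ e → f - G ^ p = ξ ^ (p * e) * F →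
      ∃ g h : K, g ∈ S ∧ h ∈ S' ∧ G = g + ξ ^ e * h)
    (hL7 : ∀ (m : ℕ) (T : Subring K) [IsLocalRing T],
      (∀ z : K, z ∈ T ↔ ∃ a b : R (j (m + 1)), b ∉ P (j (m + 1)) ∧ z = (a : K) / b) → ∀ (f g : T),
        (∀ N : ℕ, (∀ h : T, f - h ^ p ∉ maximalIdeal T ^ (N + 1)) → f - g ^ p ∈ maximalIdeal T ^ N →
            ∃ D : Derivation ℤ T T, D f ∉ maximalIdeal T ^ N ∨
              ((∀ y ∈ maximalIdeal T, D y ∈ maximalIdeal T) ∧ D f ∉ maximalIdeal T ^ (N + 1))))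
    (hperf : ∀ (m : ℕ) (T : Subring K) [IsLocalRing T],
      (∀ z : K, z ∈ T ↔ ∃ a b : R (j (m + 1)), b ∉ P (j (m + 1)) ∧ z = (a : K) / b) →
      PerfectField (IsLocalRing.ResidueField T)) :
    ¬ (∀ (L : Type) [Field L] [CharP L p] (S : ℕ → Subring L) [∀ m, IsLocalRing (S m)]
        (hle : ∀ m, S m ≤ S (m + 1)) (f g : ∀ m, S m) (x : ∀ m, S (m + 1)) (e : ℕ → ℕ) (_he : ∀ m, 1 ≤ e m)
        (_hinf : ∀ m₀, ∃ m, m₀ ≤ m ∧ 2 ≤ e m),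
        (∀ m, IsRegularLocalRing (S m)) → (∀ m, IsExcellentRing (S m)) → (∀ m, ringKrullDim (S m) = c) →
        (∀ m, IsQuadraticTransform (S m) (S (m + 1))) →
        (∀ m, Ideal.span ((fun y : S m => (⟨(y : L), hle m y.2⟩ : S (m + 1))) '' (maximalIdeal (S m) : Set (S m)))
            = Ideal.span {x m}) →
        (∀ m, ((f (m + 1) : S (m + 1)) : L) * ((x m : S (m + 1)) : L) ^ (p * e m) =
            ((f m : S m) : L) - ((g m : S m) : L) ^ p) →
        (∀ m, ∃ h : S m, f m - h ^ p ∈ maximalIdeal (S m) ^ p) →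
        (∀ m, ∀ N : ℕ, (∀ h : S m, f m - h ^ p ∉ maximalIdeal (S m) ^ (N + 1)) → f m - g m ^ p ∈ maximalIdeal (S m) ^ N →
            ∃ D : Derivation ℤ (S m) (S m), D (f m) ∉ maximalIdeal (S m) ^ N ∨
              ((∀ y ∈ maximalIdeal (S m), D y ∈ maximalIdeal (S m)) ∧ D (f m) ∉ maximalIdeal (S m) ^ (N + 1))) →
        (∀ m, PerfectField (IsLocalRing.ResidueField (S m))) →
        (∀ m, ∀ (Q : Ideal (AdjoinRoot ((X : (S m)[X]) ^ p - C (f m)))) [Q.IsPrime],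
            (∃ Q' : Ideal (AdjoinRoot ((X : (S m)[X]) ^ p - C (f m))), Q'.IsPrime ∧ Q < Q') →
            IsRegularLocalRing (Localization.AtPrime Q)) →
        False) := by
  intro hNo
  obtain ⟨S, hSloc, hle, f, g, x, e, he, hinf', hreg, hexc, hdim, hqt, hspan, hlaw, hmult', hiso, hS⟩ :=
    exists_strippedChain_of_thread p O A₀ h₀ hfg R P s c hR0 hbl hst hsp hregR j hj W hWprime hWP hWcomap hhit hinf hht hquot hmult hmin hCD
  exact hNo K S hle f g x e he hinf' hreg hexc hdim hqt hspan hlaw hmult' (fun m => hL7 m (S m) (hS m) (f m) (g m))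
    (fun m => hperf m (S m) (hS m)) hiso

end Summit.ResolutionOfSingularities.ResolutionOfSingularities.Theorems.SwitchingDichotomy.StrippedThreadExists

end
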